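import Mathlib
import Summits.Ventures.PercRepro2.Defs
import Summits.Ventures.PercRepro2.Graph
import Summits.Ventures.PercRepro2.Harris

/-!
# The connection-pattern cells of four marked vertices (blind cell PercRepro2, p2 g36)

For the marks `a₂, v, o, b` the six pairwise connection events
`F = {a₂ ↔ v}, O = {a₂ ↔ o}, B = {a₂ ↔ b}, W = {v ↔ o}, B_v = {v ↔ b}, D = {o ↔ b}`
cut the configuration space into `2⁶ = 64` cells `cell n` (`n : Fin 64`, bit `i` of `n` = the `i`-th
event holds).  The cells are pairwise disjoint and cover everything, so for every event `A`

  `P(A) = Σ_n P(A ∩ cell n)`   (`prob_eq_sum_cells`),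

and for an event of the form `{ω | Φ (pattern ω)}` (a Boolean combination of the six connections)
`P(A) = Σ_n [Φ n] · P(cell n)` (`prob_pattern_eq_sum`).  Only the `15` cells whose pattern is
transitive are non-empty (`cell_eq_empty_of_not_trans`); this is the arithmetic interface on which the
exact degree-4 certificate of `zpp ≥ 0` (proofs/P2-G36-CERT-ZPP.md) is a polynomial identity in the
fifteen atom probabilities.  Std axioms.
-/

namespace Summit.Ventures.PercRepro2

namespace RowC1

section Cells

variable {V : Type*} {E : Type*} [Fintype E] [DecidableEq E]
  {R : Type*} [Field R] [LinearOrder R] [IsStrictOrderedRing R]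

/-- The six pairwise connection events of `(a₂, v, o, b)`, in the order
`a₂v, a₂o, a₂b, vo, vb, ob`. -/
def connSix (ends : E → Sym2 V) (v a₂ o b : V) : Fin 6 → Set (Config E) :=
  ![connEvent ends a₂ v, connEvent ends a₂ o, connEvent ends a₂ b,
    connEvent ends v o, connEvent ends v b, connEvent ends o b]

open scoped Classical in
/-- The pattern of a configuration: bit `i` is set iff the `i`-th connection holds. -/
noncomputable def pattern (ends : E → Sym2 V) (v a₂ o b : V) (ω : Config E) : Fin 64 :=
  ⟨∑ i : Fin 6, (if ω ∈ connSix ends v a₂ o b i then 2 ^ (i : ℕ) else 0), by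
    classical
    have h : ∀ i : Fin 6, (if ω ∈ connSix ends v a₂ o b i then 2 ^ (i : ℕ) else 0) ≤ 2 ^ (i : ℕ) := by
      intro i; split_ifs <;> simp
    calc ∑ i : Fin 6, (if ω ∈ connSix ends v a₂ o b i then 2 ^ (i : ℕ) else 0)
        ≤ ∑ i : Fin 6, 2 ^ (i : ℕ) := Finset.sum_le_sum fun i _ => h i
      _ = 63 := by decide
      _ < 64 := by norm_num⟩

/-- The cell of a pattern `n`: the configurations whose pattern is `n`. -/
def cell (ends : E → Sym2 V) (v a₂ o b : V) (n : Fin 64) : Set (Config E) :=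
  {ω | pattern ends v a₂ o b ω = n}

omit [Fintype E] [DecidableEq E] in
/-- Membership in a cell. -/
lemma mem_cell {ends : E → Sym2 V} {v a₂ o b : V} {n : Fin 64} {ω : Config E} :
    ω ∈ cell ends v a₂ o b n ↔ pattern ends v a₂ o b ω = n := Iff.rfl

omit [LinearOrder R] [IsStrictOrderedRing R] in
/-- **The cells partition every event**: `P(A) = Σ_n P(A ∩ cell n)`. -/
theorem prob_eq_sum_cells (p : E → R) (ends : E → Sym2 V) (v a₂ o b : V) (A : Set (Config E)) :
    prob p A = ∑ n : Fin 64, prob p (A ∩ cell ends v a₂ o b n) := by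
  classical
  unfold prob
  rw [Finset.sum_comm]
  refine Finset.sum_congr rfl fun ω _ => ?_
  by_cases hA : ω ∈ A
  · have h1 : ∀ n : Fin 64, (A ∩ cell ends v a₂ o b n).indicator (weight p) ω =
        if n = pattern ends v a₂ o b ω then weight p ω else 0 := by
      intro n
      by_cases hn : n = pattern ends v a₂ o b ω
      · subst hn; simp [Set.indicator, hA, mem_cell]
      · simp [Set.indicator, hA, mem_cell, Ne.symm hn, hn]
    rw [Finset.sum_congr rfl (fun n _ => h1 n), Finset.sum_ite_eq']
    simp [Set.indicator, hA]
  · simp [Set.indicator, hA]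

omit [LinearOrder R] [IsStrictOrderedRing R] in
/-- An event defined by a predicate on the pattern: `P({ω | Φ (pattern ω)}) = Σ_n [Φ n] P(cell n)`. -/
theorem prob_pattern_eq_sum (p : E → R) (ends : E → Sym2 V) (v a₂ o b : V)
    (Φ : Fin 64 → Prop) [DecidablePred Φ] :
    prob p {ω | Φ (pattern ends v a₂ o b ω)} =
      ∑ n : Fin 64, if Φ n then prob p (cell ends v a₂ o b n) else 0 := by
  rw [prob_eq_sum_cells p ends v a₂ o b]
  refine Finset.sum_congr rfl fun n _ => ?_
  by_cases hn : Φ n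
  · simp only [hn, if_true]
    congr 1
    ext ω
    simp only [Set.mem_inter_iff, Set.mem_setOf_eq, mem_cell]
    constructor
    · exact fun h => h.2
    · intro h; exact ⟨by rw [h]; exact hn, h⟩
  · simp only [hn, if_false]
    have : {ω | Φ (pattern ends v a₂ o b ω)} ∩ cell ends v a₂ o b n = ∅ := by
      ext ω
      simp only [Set.mem_inter_iff, Set.mem_setOf_eq, mem_cell, Set.mem_empty_iff_false, iff_false]
      rintro ⟨h1, h2⟩
      exact hn (h2 ▸ h1)
    rw [this, prob_empty]

/-- The finite core of the bit lemma. -/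
theorem testBit_sum_pow (f : Fin 6 → Bool) (j : Fin 6) :
    Nat.testBit (∑ i : Fin 6, if f i then 2 ^ (i : ℕ) else 0) j = f j := by
  revert f j
  decide

omit [Fintype E] [DecidableEq E] in
/-- Bit `i` of the pattern is the `i`-th connection. -/
theorem mem_connSix_iff_testBit (ends : E → Sym2 V) (v a₂ o b : V) (ω : Config E) (i : Fin 6) :
    ω ∈ connSix ends v a₂ o b i ↔ Nat.testBit (pattern ends v a₂ o b ω).val i = true := by
  classical
  have h := testBit_sum_pow (fun i => decide (ω ∈ connSix ends v a₂ o b i)) i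
  simp only [decide_eq_true_eq] at h
  unfold pattern
  simp only
  rw [h]
  simp

/-- Transitivity of the six connections, as a decidable predicate on patterns: the twelve
implications `xy ∧ yz → xz` for the triples of `{a₂, v, o, b}`
(bits: `0 = a₂v, 1 = a₂o, 2 = a₂b, 3 = vo, 4 = vb, 5 = ob`). -/
def IsTrans6 (n : Fin 64) : Prop :=
  (Nat.testBit n.val 0 = true ∧ Nat.testBit n.val 1 = true → Nat.testBit n.val 3 = true) ∧
  (Nat.testBit n.val 0 = true ∧ Nat.testBit n.val 3 = true → Nat.testBit n.val 1 = true) ∧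
  (Nat.testBit n.val 1 = true ∧ Nat.testBit n.val 3 = true → Nat.testBit n.val 0 = true) ∧
  (Nat.testBit n.val 0 = true ∧ Nat.testBit n.val 2 = true → Nat.testBit n.val 4 = true) ∧
  (Nat.testBit n.val 0 = true ∧ Nat.testBit n.val 4 = true → Nat.testBit n.val 2 = true) ∧
  (Nat.testBit n.val 2 = true ∧ Nat.testBit n.val 4 = true → Nat.testBit n.val 0 = true) ∧
  (Nat.testBit n.val 1 = true ∧ Nat.testBit n.val 2 = true → Nat.testBit n.val 5 = true) ∧
  (Nat.testBit n.val 1 = true ∧ Nat.testBit n.val 5 = true → Nat.testBit n.val 2 = true) ∧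
  (Nat.testBit n.val 2 = true ∧ Nat.testBit n.val 5 = true → Nat.testBit n.val 1 = true) ∧
  (Nat.testBit n.val 3 = true ∧ Nat.testBit n.val 4 = true → Nat.testBit n.val 5 = true) ∧
  (Nat.testBit n.val 3 = true ∧ Nat.testBit n.val 5 = true → Nat.testBit n.val 4 = true) ∧
  (Nat.testBit n.val 4 = true ∧ Nat.testBit n.val 5 = true → Nat.testBit n.val 3 = true)

/-- `IsTrans6` is decidable. -/
instance instDecidableIsTrans6 (n : Fin 64) : Decidable (IsTrans6 n) := by unfold IsTrans6; infer_instance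

omit [Fintype E] [DecidableEq E] in
/-- Bit `0` of the pattern is `a₂ ↔ v`. -/
theorem testBit_pattern_zero (ends : E → Sym2 V) (v a₂ o b : V) (ω : Config E) :
    Nat.testBit (pattern ends v a₂ o b ω).val 0 = true ↔ Conn ends ω a₂ v :=
  (mem_connSix_iff_testBit ends v a₂ o b ω 0).symm

omit [Fintype E] [DecidableEq E] in
/-- Bit `1` of the pattern is `a₂ ↔ o`. -/
theorem testBit_pattern_one (ends : E → Sym2 V) (v a₂ o b : V) (ω : Config E) :
    Nat.testBit (pattern ends v a₂ o b ω).val 1 = true ↔ Conn ends ω a₂ o :=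
  (mem_connSix_iff_testBit ends v a₂ o b ω 1).symm

omit [Fintype E] [DecidableEq E] in
/-- Bit `2` of the pattern is `a₂ ↔ b`. -/
theorem testBit_pattern_two (ends : E → Sym2 V) (v a₂ o b : V) (ω : Config E) :
    Nat.testBit (pattern ends v a₂ o b ω).val 2 = true ↔ Conn ends ω a₂ b :=
  (mem_connSix_iff_testBit ends v a₂ o b ω 2).symm

omit [Fintype E] [DecidableEq E] in
/-- Bit `3` of the pattern is `v ↔ o`. -/
theorem testBit_pattern_three (ends : E → Sym2 V) (v a₂ o b : V) (ω : Config E) :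
    Nat.testBit (pattern ends v a₂ o b ω).val 3 = true ↔ Conn ends ω v o :=
  (mem_connSix_iff_testBit ends v a₂ o b ω 3).symm

omit [Fintype E] [DecidableEq E] in
/-- Bit `4` of the pattern is `v ↔ b`. -/
theorem testBit_pattern_four (ends : E → Sym2 V) (v a₂ o b : V) (ω : Config E) :
    Nat.testBit (pattern ends v a₂ o b ω).val 4 = true ↔ Conn ends ω v b :=
  (mem_connSix_iff_testBit ends v a₂ o b ω 4).symm

omit [Fintype E] [DecidableEq E] in
/-- Bit `5` of the pattern is `o ↔ b`. -/
theorem testBit_pattern_five (ends : E → Sym2 V) (v a₂ o b : V) (ω : Config E) :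
    Nat.testBit (pattern ends v a₂ o b ω).val 5 = true ↔ Conn ends ω o b :=
  (mem_connSix_iff_testBit ends v a₂ o b ω 5).symm

omit [Fintype E] [DecidableEq E] in
/-- Every pattern of a configuration is transitive (`conn_trans`, `conn_symm`). -/
theorem pattern_isTrans (ends : E → Sym2 V) (v a₂ o b : V) (ω : Config E) :
    IsTrans6 (pattern ends v a₂ o b ω) := by
  unfold IsTrans6
  rw [testBit_pattern_zero, testBit_pattern_one, testBit_pattern_two, testBit_pattern_three,
    testBit_pattern_four, testBit_pattern_five]
  refine ⟨?_, ?_, ?_, ?_, ?_, ?_, ?_, ?_, ?_, ?_, ?_, ?_⟩ <;> rintro ⟨hx, hy⟩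
  · exact conn_trans (conn_symm hx) hy
  · exact conn_trans hx hy
  · exact conn_trans hx (conn_symm hy)
  · exact conn_trans (conn_symm hx) hy
  · exact conn_trans hx hy
  · exact conn_trans hx (conn_symm hy)
  · exact conn_trans (conn_symm hx) hy
  · exact conn_trans hx hy
  · exact conn_trans hx (conn_symm hy)
  · exact conn_trans (conn_symm hx) hy
  · exact conn_trans hx hy
  · exact conn_trans hx (conn_symm hy)

omit [Fintype E] [DecidableEq E] in
/-- A non-transitive pattern has an empty cell. -/
theorem cell_eq_empty_of_not_trans (ends : E → Sym2 V) (v a₂ o b : V) {n : Fin 64}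
    (hn : ¬ IsTrans6 n) : cell ends v a₂ o b n = ∅ := by
  ext ω
  simp only [mem_cell, Set.mem_empty_iff_false, iff_false]
  intro h
  exact hn (h ▸ pattern_isTrans ends v a₂ o b ω)

omit [LinearOrder R] [IsStrictOrderedRing R] in
/-- A non-transitive pattern has a cell of probability `0`. -/
theorem prob_cell_eq_zero_of_not_trans (p : E → R) (ends : E → Sym2 V) (v a₂ o b : V) {n : Fin 64}
    (hn : ¬ IsTrans6 n) : prob p (cell ends v a₂ o b n) = 0 := by
  rw [cell_eq_empty_of_not_trans ends v a₂ o b hn, prob_empty]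

omit [LinearOrder R] [IsStrictOrderedRing R] in
/-- The pattern-sum restricted to the transitive (non-empty) cells:
`P({ω | Φ (pattern ω)}) = Σ_{n transitive, Φ n} P(cell n)`. -/
theorem prob_pattern_eq_sum_trans (p : E → R) (ends : E → Sym2 V) (v a₂ o b : V)
    (Φ : Fin 64 → Prop) [DecidablePred Φ] :
    prob p {ω | Φ (pattern ends v a₂ o b ω)} =
      ∑ n ∈ Finset.univ.filter (fun n => IsTrans6 n ∧ Φ n), prob p (cell ends v a₂ o b n) := by
  rw [prob_pattern_eq_sum, ← Finset.sum_filter]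
  symm
  apply Finset.sum_subset
  · intro n hn
    simp only [Finset.mem_filter, Finset.mem_univ, true_and] at hn ⊢
    exact hn.2
  · intro n hn hn'
    simp only [Finset.mem_filter, Finset.mem_univ, true_and, not_and] at hn hn'
    exact prob_cell_eq_zero_of_not_trans p ends v a₂ o b (fun ht => hn' ht hn)

omit [LinearOrder R] [IsStrictOrderedRing R] in
/-- Total mass one over the fifteen transitive cells. -/
theorem sum_cells_trans_eq_one (p : E → R) (ends : E → Sym2 V) (v a₂ o b : V) :
    ∑ n ∈ Finset.univ.filter (fun n => IsTrans6 n ∧ True), prob p (cell ends v a₂ o b n) = 1 := by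
  rw [← prob_pattern_eq_sum_trans p ends v a₂ o b (fun _ => True)]
  simp only [Set.setOf_true]
  exact prob_univ p

end Cells

end RowC1

end Summit.Ventures.PercRepro2
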